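import Summits.HodgeConjecture.HodgeConjecture.Theorems.F0P3cStCharTSWeylHypWIF           -- ★ p849936∕p849950 (LH2-p02 (g3)): «(WIF-σ)» radial form `exists_radialMeasure_integral_mul_classFun` (unconditional)
import Summits.HodgeConjecture.HodgeConjecture.Theorems.F0P3cStCharTSTorusRay              -- ★ p849339 (LH6-p05 (g2)): `M` second countable ∕ locally compact
import Summits.HodgeConjecture.HodgeConjecture.Theorems.F0P3cStCharTSTorusLevelBasis       -- ★ p849662 (LH6-p03 (g0)): cosets `isOpen_smul_coe`
import HarnessLib

/-!
# F0 · P3c · line LH6 «StCharTS» — road «W» (WEYL DISCHARGE), step (B₀): coset uniqueness for measures, and the radial Weyl measure read on the parameter torus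
# `M = E_vˣ × E¹_v` of the organ's group `Gqs L v` (Rogawski 1990 §12.5 p. 182; Harish-Chandra 1970 Lemma 42)

Cell `pub/hodgecm-mathlib`, crux H413 = `stmt-HodgeConjecture-24833` (`--supports` lane, helper), route HCCMUnconditional; seat LH6-p01 (g3), integrator of the
(TOR) road.  THEOREMS ONLY, sorry-free, ★-only imports.  Two inputs of ★ `…WeylCoreDensity.weylIntegration_core_of_shells` (next file):
* §1 (abstract, any second-countable topological group `G`): `isPiSystem_smul_coe` — the cosets of a nested family of subgroups form a π-system;
  **`restrict_eq_restrict_of_forall_smul_coe`** — two measures agreeing on every coset `u • H n` (`u ∈ S`) of a nested OPEN neighbourhood basis `(H n)` of subgroups,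
  the first finite on cosets, agree on the union `S` of `H 0`-cosets (Mathlib `Measure.ext_of_generateFrom_of_iUnion`: the cosets are a topological basis, hence
  generate the Borel σ-algebra; the `H 0`-cosets through a dense sequence cover; a coset lies in `S` or misses it).
* §2 **`exists_radialMeasure_torusParam`** — ★ `exists_radialMeasure_integral_mul_classFun` (LH2-p02, «(WIF-σ)» on `T`, unconditional) transported along the chart
  `ι = torusChart` to `M` and read on the ORGAN's carrier `Gqs L v` (the measurable structures of `U(Φ₃)(L⁺_v)` are those of `Gqs L v`, definitionally; cf. ★ p849653):
  a measure `σ_M` on `M`, finite on compact sets, with `∫_G φ·α dν = ∫_M O(φ, ι m)·α(ι m) dσ_M` (and integrability of the integrand) for measurable `φ, α` with `α`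
  conjugation-invariant, `φ·α` integrable on the hyperbolic set and `φ = 0` off it.
HONEST LABEL: HC_CM is proved only modulo the 7 printed citations (2 remaining: hLiu418 = stmt-HodgeConjecture-24832, h413 = stmt-HodgeConjecture-24833) until rung 0
closes; count-neutral plumbing.

## References
* [Rogawski1990] J. D. Rogawski, *Automorphic Representations of Unitary Groups in Three Variables*, Ann. of Math. Stud. 123 (1990), §12.5 p. 182; §12.7 L. 12.7.2 (proof) p. 193.
* [HarishChandra1970] Harish-Chandra, *Harmonic analysis on reductive p-adic groups*, LNM 162 (1970), Lemma 42.
* [Casselman1995] W. Casselman, *Introduction to the theory of admissible representations of p-adic reductive groups* (1995 notes), §1.4 Prop. 1.4.4 p. 14.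
-/

set_option autoImplicit false
-- the mandated namespace has the single-problem summit's repeated segment (`HodgeConjecture.HodgeConjecture`)
set_option linter.dupNamespace false

noncomputable section

open NumberField IsDedekindDomain MeasureTheory MeasureTheory.Measure Filter Topology Set
open scoped Matrix MatrixGroups NNReal ENNReal Pointwise
open Literature.NumberTheory.Rogawski1990 Literature.NumberTheory.Automorphic Literature.NumberTheory.Automorphic.UnitaryGroup
open Literature.MeasureTheory.Group
open Summit.HodgeConjecture.HodgeConjecture.Cruxes.H413.F0P3cStCharTSTorusDefs
open Summit.HodgeConjecture.HodgeConjecture.Cruxes.H413.F0P3cStCharTSTorusChartIso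
open Summit.HodgeConjecture.HodgeConjecture.Cruxes.H413.F0P3cStCharTSTorusRay
open Summit.HodgeConjecture.HodgeConjecture.Cruxes.H413.F0P3cStCharTSWeylHypWIF
open Summit.HodgeConjecture.HodgeConjecture.Cruxes.H413.F0P3cStCharTSTorusLevelBasis

namespace Summit.HodgeConjecture.HodgeConjecture.Cruxes.H413.F0P3cStCharTSWeylCoreRadial

/-! ## §1 Coset uniqueness for measures on a group with a nested open basis of subgroups (abstract) -/

section Abstract

variable {G : Type*} [Group G]

/-- **The cosets of a nested family of subgroups form a π-system**: two cosets that meet in a point `x` are the cosets through `x`, and the coset of the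
smaller subgroup is their intersection. [cite: Casselman1995, §1.4 Prop. 1.4.4 p. 14] -/
theorem isPiSystem_smul_coe (H : ℕ → Subgroup G) (hH : Antitone H) :
    IsPiSystem {E : Set G | ∃ (u : G) (n : ℕ), E = u • (H n : Set G)} := by
  rintro _ ⟨u, n, rfl⟩ _ ⟨u', m, rfl⟩ ⟨x, hx, hx'⟩
  have h1 : u • (H n : Set G) = x • (H n : Set G) := (leftCoset_eq_iff (H n)).2 ((mem_leftCoset_iff u).1 hx)
  have h2 : u' • (H m : Set G) = x • (H m : Set G) := (leftCoset_eq_iff (H m)).2 ((mem_leftCoset_iff u').1 hx')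
  rw [h1, h2]
  rcases le_total n m with hnm | hmn
  · exact ⟨x, m, Set.inter_eq_right.2 (Set.smul_set_mono (SetLike.coe_subset_coe.2 (hH hnm)))⟩
  · exact ⟨x, n, Set.inter_eq_left.2 (Set.smul_set_mono (SetLike.coe_subset_coe.2 (hH hmn)))⟩

variable [TopologicalSpace G] [IsTopologicalGroup G] [MeasurableSpace G] [BorelSpace G] [SecondCountableTopology G]

/-- **COSET UNIQUENESS ON A UNION OF COSETS.**  `H n` a nested family of OPEN subgroups forming a neighbourhood basis of `1`, `S` a union of `H 0`-cosets, `μ` finite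
on cosets: if `μ` and `ν` agree on every coset `u • H n` with `u ∈ S`, then `μ|_S = ν|_S` — the cosets are a π-system generating the Borel σ-algebra (they form a
topological basis), the `H 0`-cosets through a dense sequence cover, and a coset either lies in `S` or misses it (Mathlib `Measure.ext_of_generateFrom_of_iUnion` on the
restricted measures). [cite: Casselman1995, §1.4 Prop. 1.4.4 p. 14] -/
theorem restrict_eq_restrict_of_forall_smul_coe
    (H : ℕ → Subgroup G) (hHo : ∀ n, IsOpen (H n : Set G)) (hH : Antitone H)
    (hbasis : ∀ V ∈ 𝓝 (1 : G), ∃ n, (H n : Set G) ⊆ V)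
    {S : Set G} (hS : ∀ u ∈ S, u • (H 0 : Set G) ⊆ S)
    (μ ν : Measure G) (hfin : ∀ (u : G) (n : ℕ), μ (u • (H n : Set G)) ≠ ⊤)
    (h : ∀ u ∈ S, ∀ n : ℕ, μ (u • (H n : Set G)) = ν (u • (H n : Set G))) :
    μ.restrict S = ν.restrict S := by
  classical
  set C : Set (Set G) := {E : Set G | ∃ (u : G) (n : ℕ), E = u • (H n : Set G)} with hC
  -- the cosets form a topological basis
  have hbasisC : TopologicalSpace.IsTopologicalBasis C := by
    refine TopologicalSpace.isTopologicalBasis_of_isOpen_of_nhds ?_ ?_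
    · rintro _ ⟨u, n, rfl⟩
      exact isOpen_smul_coe (hHo n) u
    · intro x V hxV hV
      have hV1 : x⁻¹ • V ∈ 𝓝 (1 : G) := by
        refine (hV.smul x⁻¹).mem_nhds ?_
        have := Set.smul_mem_smul_set (a := x⁻¹) hxV
        rwa [smul_eq_mul, inv_mul_cancel] at this
      obtain ⟨n, hn⟩ := hbasis _ hV1
      refine ⟨x • (H n : Set G), ⟨x, n, rfl⟩, ?_, ?_⟩
      · exact Set.mem_smul_set.2 ⟨1, (H n).one_mem, by rw [smul_eq_mul, mul_one]⟩
      · have := Set.smul_set_mono (a := x) hn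
        rwa [smul_inv_smul] at this
  have hgen : ‹MeasurableSpace G› = MeasurableSpace.generateFrom C := by
    rw [‹BorelSpace G›.measurable_eq]
    exact hbasisC.borel_eq_generateFrom
  have hpi : IsPiSystem C := isPiSystem_smul_coe H hH
  -- a countable cover by `H 0`-cosets through a dense sequence
  haveI : Nonempty G := ⟨1⟩
  obtain ⟨d, hd⟩ := TopologicalSpace.exists_dense_seq G
  refine Measure.ext_of_generateFrom_of_iUnion C (fun i => d i • (H 0 : Set G)) hgen hpi ?_ (fun i => ⟨d i, 0, rfl⟩) ?_ ?_
  · refine Set.eq_univ_of_forall fun x => ?_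
    obtain ⟨i, hi⟩ := hd.exists_mem_open (isOpen_smul_coe (hHo 0) x)
      ⟨x, Set.mem_smul_set.2 ⟨1, (H 0).one_mem, by rw [smul_eq_mul, mul_one]⟩⟩
    have heq : x • (H 0 : Set G) = d i • (H 0 : Set G) := (leftCoset_eq_iff (H 0)).2 ((mem_leftCoset_iff x).1 hi)
    exact Set.mem_iUnion.2 ⟨i, heq ▸ Set.mem_smul_set.2 ⟨1, (H 0).one_mem, by rw [smul_eq_mul, mul_one]⟩⟩
  · intro i
    exact ne_top_of_le_ne_top (hfin (d i) 0) (Measure.restrict_le_self _)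
  · rintro _ ⟨u, n, rfl⟩
    have hmeas : MeasurableSet (u • (H n : Set G)) := (isOpen_smul_coe (hHo n) u).measurableSet
    rw [Measure.restrict_apply hmeas, Measure.restrict_apply hmeas]
    have hn0 : (H n : Set G) ⊆ (H 0 : Set G) := SetLike.coe_subset_coe.2 (hH (Nat.zero_le n))
    by_cases hu : u ∈ S
    · rw [Set.inter_eq_left.2 ((Set.smul_set_mono hn0).trans (hS u hu))]
      exact h u hu n
    · have hdisj : u • (H n : Set G) ∩ S = ∅ := by
        refine Set.eq_empty_iff_forall_notMem.2 fun x hx => hu ?_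
        have hx0 : x ∈ u • (H 0 : Set G) := Set.smul_set_mono hn0 hx.1
        have heq : u • (H 0 : Set G) = x • (H 0 : Set G) := (leftCoset_eq_iff (H 0)).2 ((mem_leftCoset_iff u).1 hx0)
        have hux : u ∈ x • (H 0 : Set G) := heq ▸ Set.mem_smul_set.2 ⟨1, (H 0).one_mem, by rw [smul_eq_mul, mul_one]⟩
        exact hS x hx.2 hux
      rw [hdisj, measure_empty, measure_empty]

end Abstract

/-! ## §2 The radial Weyl measure on the parameter torus `M`, read on the organ's carrier -/

section CM

variable (L : Type) [Field L] [NumberField L] [IsCMField L] (v : HeightOneSpectrum (𝓞 ↥(maximalRealSubfield L)))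

set_option maxHeartbeats 1600000 in
set_option synthInstance.maxHeartbeats 400000 in
-- instance transport between the organ carrier `Gqs L v` and the matrix carrier (cf. ★ p849653, ★ p849841)
/-- **«(WIF-σ)» ON `M`, ORGAN CURRENCY.**  `v` non-split; `νQv` a Haar measure on `Gqs L v = U(Φ₃)(L⁺_v)` with canonical orbital measures `mQv`; `M = E_vˣ × E¹_v` with its Borel
structure.  There is a measure `σ_M` on `M`, finite on compact sets, such that for all measurable `φ α : Gqs L v → ℂ` with `α` conjugation-invariant, `φ·α` integrable on
`hyperbolicSet L v` and `φ = 0` off it: `m ↦ O(φ, ι m)·α(ι m)` is `σ_M`-integrable and **`∫ φ α dνQv = ∫_M O(φ, ι m)·α(ι m) dσ_M`** (`ι = torusChart L v`, `O` the canonical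
class orbital integral) — ★ `exists_radialMeasure_integral_mul_classFun` transported along ★ `torusChartEquiv`. [cite: Rogawski1990, §12.5 p. 182; §12.7 L. 12.7.2 (proof) p. 193]
[cite: HarishChandra1970, Lemma 42] -/
theorem exists_radialMeasure_torusParam
    (hns : ∀ w : PlacesOver L v, IsCMField.complexConj L • w.1 = w.1)
    [MeasurableSpace (Gqs L v)] [BorelSpace (Gqs L v)]
    [∀ γ : Gqs L v, MeasurableSpace (Gqs L v ⧸ Subgroup.centralizer ({γ} : Set (Gqs L v)))]
    [∀ γ : Gqs L v, BorelSpace (Gqs L v ⧸ Subgroup.centralizer ({γ} : Set (Gqs L v)))]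
    (νQv : Measure (Gqs L v)) [νQv.IsHaarMeasure] [νQv.IsMulRightInvariant]
    {mQv : OrbitalMeasureFamily (Gqs L v)}
    (hcanQ : mQv.IsCanonical (fun γ => IsRegularElt (γ.val : GL (Fin 3) (LocalRing L v))) νQv)
    [MeasurableSpace ((LocalRing L v)ˣ × ↥(normOneUnits (conjLocal L (IsCMField.complexConj L) v)))] [BorelSpace ((LocalRing L v)ˣ × ↥(normOneUnits (conjLocal L (IsCMField.complexConj L) v)))] :
    ∃ σM : Measure ((LocalRing L v)ˣ × ↥(normOneUnits (conjLocal L (IsCMField.complexConj L) v))), IsFiniteMeasureOnCompacts σM ∧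
      ∀ φ₀ α₀ : Gqs L v → ℂ, Measurable φ₀ → Measurable α₀ → (∀ x h : Gqs L v, α₀ (h * x * h⁻¹) = α₀ x) →
        IntegrableOn (fun x => φ₀ x * α₀ x) (hyperbolicSet L v) νQv → (∀ x : Gqs L v, x ∉ hyperbolicSet L v → φ₀ x = 0) →
        Integrable (fun m : ((LocalRing L v)ˣ × ↥(normOneUnits (conjLocal L (IsCMField.complexConj L) v))) => classOrbitalIntegral mQv φ₀ (ConjClasses.mk (((torusChart L v m : ↥(cmBorelTriple L 3 v).M) : ↥(unitaryGroupOfForm (conjLocal L (IsCMField.complexConj L) v) (cmLocalForm L 3 v))) : Gqs L v)) * α₀ (((torusChart L v m : ↥(cmBorelTriple L 3 v).M) : ↥(unitaryGroupOfForm (conjLocal L (IsCMField.complexConj L) v) (cmLocalForm L 3 v))) : Gqs L v)) σM ∧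
          ∫ x, φ₀ x * α₀ x ∂νQv = ∫ m : ((LocalRing L v)ˣ × ↥(normOneUnits (conjLocal L (IsCMField.complexConj L) v))), classOrbitalIntegral mQv φ₀ (ConjClasses.mk (((torusChart L v m : ↥(cmBorelTriple L 3 v).M) : ↥(unitaryGroupOfForm (conjLocal L (IsCMField.complexConj L) v) (cmLocalForm L 3 v))) : Gqs L v)) * α₀ (((torusChart L v m : ↥(cmBorelTriple L 3 v).M) : ↥(unitaryGroupOfForm (conjLocal L (IsCMField.complexConj L) v) (cmLocalForm L 3 v))) : Gqs L v) ∂σM := by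
  -- the organ's measurable structures, re-read on the (definitionally equal) matrix carrier
  letI hmsU : MeasurableSpace ↥(unitaryGroupOfForm (conjLocal L (IsCMField.complexConj L) v) (cmLocalForm L 3 v)) := ‹MeasurableSpace (Gqs L v)›
  haveI : BorelSpace ↥(unitaryGroupOfForm (conjLocal L (IsCMField.complexConj L) v) (cmLocalForm L 3 v)) := ⟨BorelSpace.measurable_eq (α := Gqs L v)⟩
  letI : ∀ γ : ↥(unitaryGroupOfForm (conjLocal L (IsCMField.complexConj L) v) (cmLocalForm L 3 v)), MeasurableSpace (↥(unitaryGroupOfForm (conjLocal L (IsCMField.complexConj L) v) (cmLocalForm L 3 v)) ⧸ Subgroup.centralizer ({γ} : Set ↥(unitaryGroupOfForm (conjLocal L (IsCMField.complexConj L) v) (cmLocalForm L 3 v)))) :=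
    ‹∀ γ : Gqs L v, MeasurableSpace (Gqs L v ⧸ Subgroup.centralizer ({γ} : Set (Gqs L v)))›
  haveI : ∀ γ : ↥(unitaryGroupOfForm (conjLocal L (IsCMField.complexConj L) v) (cmLocalForm L 3 v)), BorelSpace (↥(unitaryGroupOfForm (conjLocal L (IsCMField.complexConj L) v) (cmLocalForm L 3 v)) ⧸ Subgroup.centralizer ({γ} : Set ↥(unitaryGroupOfForm (conjLocal L (IsCMField.complexConj L) v) (cmLocalForm L 3 v)))) :=
    ‹∀ γ : Gqs L v, BorelSpace (Gqs L v ⧸ Subgroup.centralizer ({γ} : Set (Gqs L v)))›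
  haveI : LocallyCompactSpace ↥(unitaryGroupOfForm (conjLocal L (IsCMField.complexConj L) v) (cmLocalForm L 3 v)) := locallyCompactSpace_local (IsCMField.complexConj L) 3 _ v
  haveI : SecondCountableTopology ↥(unitaryGroupOfForm (conjLocal L (IsCMField.complexConj L) v) (cmLocalForm L 3 v)) := secondCountableTopology_local (IsCMField.complexConj L) 3 _ v
  haveI : Measure.IsHaarMeasure (G := ↥(unitaryGroupOfForm (conjLocal L (IsCMField.complexConj L) v) (cmLocalForm L 3 v))) νQv := ‹νQv.IsHaarMeasure›
  haveI : Measure.IsMulRightInvariant (G := ↥(unitaryGroupOfForm (conjLocal L (IsCMField.complexConj L) v) (cmLocalForm L 3 v))) νQv := ‹νQv.IsMulRightInvariant›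
  obtain ⟨σ', hσfin, -, -, hrad⟩ := exists_radialMeasure_integral_mul_classFun L v hns (νQv : Measure ↥(unitaryGroupOfForm (conjLocal L (IsCMField.complexConj L) v) (cmLocalForm L 3 v))) hcanQ
  haveI := hσfin
  set e : ↥(cmBorelTriple L 3 v).M ≃ₜ ((LocalRing L v)ˣ × ↥(normOneUnits (conjLocal L (IsCMField.complexConj L) v))) := (torusChartEquiv L v).symm.toHomeomorph with hedef
  have he : ∀ t, torusChart L v (e t) = t := fun t => (torusChartEquiv L v).apply_symm_apply t
  refine ⟨Measure.map e σ', IsFiniteMeasureOnCompacts.map σ' e, fun φ₀ α₀ hφ₀ hα₀ hinv hint h0 => ?_⟩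
  obtain ⟨hI, hEq⟩ := hrad φ₀ α₀ hφ₀ hα₀ (fun x _ h => hinv x h) hint h0
  refine ⟨?_, ?_⟩
  · rw [e.measurableEmbedding.integrable_map_iff]
    refine hI.congr (Eventually.of_forall fun t => ?_)
    simp only [Function.comp_apply, he]
    rfl
  · refine (show ∫ x : Gqs L v, φ₀ x * α₀ x ∂νQv = ∫ x : ↥(unitaryGroupOfForm (conjLocal L (IsCMField.complexConj L) v) (cmLocalForm L 3 v)), φ₀ x * α₀ x ∂νQv from rfl).trans (hEq.trans ?_)
    rw [e.measurableEmbedding.integral_map]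
    refine integral_congr_ae (Eventually.of_forall fun t => ?_)
    simp only [he]
    rfl

end CM

end Summit.HodgeConjecture.HodgeConjecture.Cruxes.H413.F0P3cStCharTSWeylCoreRadial

end
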